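import Summits.QuantumFields.BalabanUV.Beta.SymRootedMixedJetSingle
import Summits.QuantumFields.BalabanUV.Beta.SymAveragingMixedJetTables
import Summits.QuantumFields.BalabanUV.Beta.SymAveragingHessianCounts
import Summits.QuantumFields.BalabanUV.Beta.RootedMixedTableLaw

/-!
# `BalabanUV.Beta.SymRootedMixedTableLaw` — THE AXIS-REFLECTION LAW OF THE (0.4)-SYMMETRISED MIXED TABLES `symATab`, `symApTab`, `symTTab`
# AND THE PACKED TABLE-LEVEL LAW OF `symMixFFAt ρ_c` (β sub-cell, row D1, TABLES-SYM-LEAN S2c∕S2d, INTERFACE-LEVEL twin of an3-g33's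
# `RootedMixedTableLaw` + leaf-05's MX4 `MixedLetterUnpacking`; an1 gen 43; the mixed REFLECTION letter (hM2) of the sym root)

HONEST FRAMING (cell charter, verbatim): «discharging BetaPertH makes Bałaban's UV stability UNCONDITIONAL — a real
constructive-QFT result; it is NOT the continuum limit and NOT the Clay problem.»  HONEST DEPENDENCY (verbatim): «continuum YM on
T⁴ ⇐ BetaPertH ∧ nine spine estimates (0/9 proved); BetaPertH ⇐ (D1) ∧ (D4) ∧ CAP+tail; G-an2-4 gates asym, D1 and NE2/3/4.»
ABSOLUTE RULE (R-g25-7 ∕ R-D1-g30-1 (A)): the (0.4)-symmetrised averaging is the exp of the MEAN OF LOGS over the pair family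
`{loop^{σ,σ′}}` with weight `((d!)²·L^d)⁻¹`; every object below is the comb module's algebra read on an1's `symPhiGAt` (S2b part 1)
instead of `PhiGAt` — STATEMENT FOR STATEMENT under the dictionary `PhiXAt ↦ symPhiXAt`, `XjetAt ↦ symXjetAt`, `MσXAt ↦ symMσXAt`,
`L^{-d}·linAvgAt ↦ (d!·L^d)⁻¹·symLinU`, `L^{-d}·hessUAt ↦ ((d!)²L^d)⁻¹·symHessUAt`, `L^{-2d}·vhUAt ↦ ((d!)²L^{2d})⁻¹·symVhUAt`
(an3-g63 [AN3-G63-S2C] (C-ii): constants PER BCH ORDER; CONVENTION `(d!)²` un-normalised inside order-2 sym functionals).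
FAMILY-INDEPENDENT chart ∕ letter ∕ `Tau`-algebra lemmas of the comb module are imported BY NAME, never re-proved.
DERIVED cell leaf: [folklore] ring algebra; the `sym*` families are [our object]s.  No statement of Bałaban's papers is typed here, no
`[cite:]` tag, no `Prop` is minted, no binder of the β-function wall (`hW`/`hR`/`D1Tel`/`D1Rep`, (D1), `BetaPertH`) is instantiated or
discharged; nothing about the VALUES of `symMixFFAt`∕`symVh₂SAt` and no (T2-B)∕(T2-M₂) letter is discharged in this file.
NOT D1, NOT BetaPertH, NOT continuum, NOT Clay.  NOT summit progress.
Provenance: β sub-cell, TABLES-SYM-LEAN S2c option (C) (S2C-SCOPE-v1 94facb80ac685517), unit b2b-balaban-beta-an1-g43 (W-supplier AN1,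
FREEZE (0): scratch for a courier; an1 files nothing), 2026-08-21; no existing file touched.

## What this module proves (sym twin of `RootedMixedTableLaw` §2–§3; its §1 `(0,3)`-entries `ent_X*`∕`ite_entry` and §3's `fref_mk`∕`contact_iff` are
## letter algebra, the comb module's BY NAME)
* §2 **`symATab_bref`, `symApTab_bref`, `symTTab_bref`** (`L` odd): the axis-reflection laws of an1's S2b tables (`SymAveragingMixedJetStructure` §6) read off
  an1's `SymRootedMixedJetSingle.symMjetAt_single_bref` at the letters `E₀₁, E₁₂, E₂₃`, entry `(0,3)` — the comb laws with `(2L^d)⁻¹ ↦ (2(d!)²L^d)⁻¹`,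
  `L^{-d}·q ↦ (d!·L^d)⁻¹·q_sym`, `[f = f′]·q ↦ [f = f′]·d!·q_sym`; in `symTTab_bref` the `q`-contacts cancel, the `X2`'s cancel, the commutator doubles exactly as
  in the comb: ONE Hessian contact `−[f = g ∧ f.1 = α]·((d!)²L^d)⁻¹·h_sym(f♯, f′♯)` and `[μ = α]·((d!)²L^d)⁻¹(d!·L^d)⁻¹·h_sym(f♯, f′♯)·q_sym(g♯)`.
* §3 at `d = 4`, root `ρ_c = ctr 4 Lc` (`Lc` odd): **`symBondLaw`** — the entrywise law of `symMixKerAt ρ_c Lc` (`= (symTTab … : ℝ)`, `rfl`) with the LANDED real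
  kernels `symHessKerAt = h_sym∕(2(d!)²L^d)`, `symLinKerAt = q_sym∕(d!·L^d)` (`SymAveragingHessianCounts`): SAME OUTER SHAPE AS THE COMB (`2·[contact]·(−1)·symHessKerAt`,
  `2·[ρ′ = α]·symLinKerAt·symHessKerAt`); **`symTableLaw_iff_bondLaw`** (MX4's matrix ⟺ bond equivalence for the ff-supported `symMixFFAt`, `symHessFFAt`);
  **`symTableLaw`**: `symMixFFAt ρ_c Lc κ (bref α κ u) ρ′ (bref α ρ′ w) = (reflSign α κ · reflSign α ρ′) • refK (Φ Lc α) (symMixFFAt ρ_c Lc κ u ρ′ w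
  + 2 • diagK (ctGen 3 α Lc κ u) ∘ symHessFFAt ρ_c Lc ρ′ w + (2·[ρ′ = α]·symLinKerAt ρ_c Lc ρ′ w (κ,u)) • symHessFFAt ρ_c Lc ρ′ w)` — the packed
  second-order MIXED REFLECTION LAW of an1's sym table, UNCONDITIONAL.  (MX2's `mixedBinders`∕`RMof` repacking is comb-socket-specific and is NOT twinned:
  the sym root `RowD1JointEndSymReflTablesAn1` consumes (hM2) in the `M2Of`∕`conjV (M1Of …)` packaging of `SpineRooted.WrecOf_brefC_of_tableLetters_sym`,
  whose repacking from `symTableLaw` is the hR-class step downstream.)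
-/

open Literature.MathematicalPhysics.QuantumFieldTheory.Balaban1983to89
open Literature.MathematicalPhysics.QuantumFieldTheory.Balaban1983to89.Beta
open scoped Nat
open ExpKernelCalculus (MKer comp)
open AffineAveraging (toSite)
open AveragingContoursRooted (ctr ctrOff)
open AveragingHessianKernels (Bond single)
open Summit.QuantumFields.BalabanUV.Beta.SymAveragingHessianCounts (symLinCountAt symHessCountAt symHessCountAt_swap symHessCountAt_self symLinKerAt symHessKerAt symHessFFAt symHessFFAt_inl_inl symHessFFAt_inl_inr symHessFFAt_inr)
open AveragingMixedJetTables (UT E)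
open Summit.QuantumFields.BalabanUV.Beta.SymAveragingMixedJetTables (symMjetAt symATab symApTab symTTab symMixKerAt symMixFFAt symMixFFAt_inl_inl symMixFFAt_inl_inr symMixFFAt_inr)
open PolarizationSign (reflSign)
open KernelReflection (refK refK_apply)
open ResolventReflection (bref bref_bref Φ Φ_r_inl Φ_s_inl)
open OneStepResolventKernel (Fib)
open RootedKernelReflection (fref)
open Summit.QuantumFields.BalabanUV.Beta.BorderedHessian (diagK ctGen ctGen_inl comp_diagK_left)
open Summit.QuantumFields.BalabanUV.Beta.RootedMixedJetSingle (sym3)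
open Summit.QuantumFields.BalabanUV.Beta.SymRootedMixedJetSingle (symMjetAt_single_bref)
open Summit.QuantumFields.BalabanUV.Beta.RootedMixedTableLaw (ent_X1_a ent_X1_ap ent_X2_a ent_X2_ap ent_X3_a ent_X3_ap ent_Xc_a ent_Xc_ap ite_entry fref_mk contact_iff)

namespace Summit.QuantumFields.BalabanUV.Beta.SymRootedMixedTableLaw

/-! ## §1 The `(0,3)` entries of the bracket words at the table letters: letter algebra, the comb module's `ent_X1_a … ent_Xc_ap ite_entry` BY NAME -/

/-! ## §2 The axis-reflection laws of the (0.4)-symmetrised tables `symATab`, `symApTab`, `symTTab` -/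

section Tables

variable {d L : ℕ} (hL : Odd L)
include hL

/-- [folklore] **THE AXIS-REFLECTION LAW OF THE TABLE `symATab`** (an1's `SymRootedMixedJetSingle.symMjetAt_single_bref`, sym twin of 33M3c, at the letters `E₀₁, E₁₂, E₂₃`,
entry `(0,3)`; §1). -/
theorem symATab_bref (α μ : Fin d) (f g f' : Bond d) (y : Fin d → ℤ) :
    symATab (ctr d L) L μ (bref α μ y) f g f'
      = (if μ = α then -1 else 1 : ℚ)
        * ((if f.1 = α then -1 else 1 : ℚ) * (if f'.1 = α then -1 else 1 : ℚ) * (if g.1 = α then -1 else 1 : ℚ))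
        * (symATab (ctr d L) L μ y (fref α f) (fref α g) (fref α f')
            - (if f' = g ∧ f'.1 = α then ((2 : ℚ) * ((d ! : ℚ) ^ 2 * (L : ℚ) ^ d))⁻¹
                * (symHessCountAt (ctr d L) L μ y (fref α f) (fref α f') + (if f = f' then (d ! : ℚ) * symLinCountAt (ctr d L) L μ y (fref α f) else 0)) else 0)
            + (if f = f' ∧ f' = g ∧ f.1 = α then ((d ! : ℚ) * (L : ℚ) ^ d)⁻¹ * symLinCountAt (ctr d L) L μ y (fref α f) * 2⁻¹ else 0)
            + (if μ = α then ((2 : ℚ) * ((d ! : ℚ) ^ 2 * (L : ℚ) ^ d))⁻¹ * ((d ! : ℚ) * (L : ℚ) ^ d)⁻¹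
                * (symHessCountAt (ctr d L) L μ y (fref α f) (fref α f') * symLinCountAt (ctr d L) L μ y (fref α g)) else 0)) := by
  simp only [symATab]
  rw [congrFun (congrFun (symMjetAt_single_bref (𝕜 := ℚ) hL two_ne_zero (Nat.cast_ne_zero.2 (Nat.factorial_ne_zero d)) (Nat.cast_ne_zero.2 hL.pos.ne') α μ f f' g (E 0 1) (E 1 2) (E 2 3) y) 0) 3]
  simp only [Matrix.smul_apply, Matrix.add_apply, ite_entry, ent_X1_a, ent_X2_a, ent_X3_a, ent_Xc_a]
  simp only [smul_eq_mul, zsmul_eq_mul, mul_zero, smul_zero, ite_self, add_zero]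
  push_cast
  generalize (if f.1 = α then -1 else 1 : ℚ) = z₁
  generalize (if f'.1 = α then -1 else 1 : ℚ) = z₂
  generalize (if g.1 = α then -1 else 1 : ℚ) = z₃
  split_ifs <;> ring

/-- [folklore] **THE AXIS-REFLECTION LAW OF THE TABLE `symApTab`** (letters `E₀₁, E₂₃, E₁₂`). -/
theorem symApTab_bref (α μ : Fin d) (f g f' : Bond d) (y : Fin d → ℤ) :
    symApTab (ctr d L) L μ (bref α μ y) f g f'
      = (if μ = α then -1 else 1 : ℚ)
        * ((if f.1 = α then -1 else 1 : ℚ) * (if f'.1 = α then -1 else 1 : ℚ) * (if g.1 = α then -1 else 1 : ℚ))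
        * (symApTab (ctr d L) L μ y (fref α f) (fref α g) (fref α f')
            + (if f = g ∧ f.1 = α then ((2 : ℚ) * ((d ! : ℚ) ^ 2 * (L : ℚ) ^ d))⁻¹
                * (symHessCountAt (ctr d L) L μ y (fref α f') (fref α f) + (if f' = f then (d ! : ℚ) * symLinCountAt (ctr d L) L μ y (fref α f') else 0)) else 0)
            + (if f' = g ∧ f'.1 = α then ((2 : ℚ) * ((d ! : ℚ) ^ 2 * (L : ℚ) ^ d))⁻¹
                * (symHessCountAt (ctr d L) L μ y (fref α f) (fref α f') + (if f = f' then (d ! : ℚ) * symLinCountAt (ctr d L) L μ y (fref α f) else 0)) else 0)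
            - (if f = f' ∧ f' = g ∧ f.1 = α then ((d ! : ℚ) * (L : ℚ) ^ d)⁻¹ * symLinCountAt (ctr d L) L μ y (fref α f) else 0)) := by
  simp only [symApTab]
  rw [congrFun (congrFun (symMjetAt_single_bref (𝕜 := ℚ) hL two_ne_zero (Nat.cast_ne_zero.2 (Nat.factorial_ne_zero d)) (Nat.cast_ne_zero.2 hL.pos.ne') α μ f f' g (E 0 1) (E 2 3) (E 1 2) y) 0) 3]
  simp only [Matrix.smul_apply, Matrix.add_apply, ite_entry, ent_X1_ap, ent_X2_ap, ent_X3_ap, ent_Xc_ap]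
  simp only [smul_eq_mul, zsmul_eq_mul, mul_zero, smul_zero, ite_self, add_zero]
  push_cast
  generalize (if f.1 = α then -1 else 1 : ℚ) = z₁
  generalize (if f'.1 = α then -1 else 1 : ℚ) = z₂
  generalize (if g.1 = α then -1 else 1 : ℚ) = z₃
  split_ifs <;> ring

/-- [folklore] **THE AXIS-REFLECTION LAW OF THE DIAGONAL RECIPE `symTTab`**: the `q`-contacts cancel, the `X2`'s cancel, the commutator doubles —
what is left is ONE Hessian contact `−[f = g ∧ f.1 = α]·((d!)²L^d)⁻¹·h_sym(f♯, f′♯)` and the doubled commutator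
`[μ = α]·((d!)²L^d)⁻¹(d!·L^d)⁻¹·h_sym(f♯, f′♯)·q_sym(g♯)`. -/
theorem symTTab_bref (α μ : Fin d) (f f' g : Bond d) (y : Fin d → ℤ) :
    symTTab (ctr d L) L μ (bref α μ y) f f' g
      = (if μ = α then -1 else 1 : ℚ)
        * ((if f.1 = α then -1 else 1 : ℚ) * (if f'.1 = α then -1 else 1 : ℚ) * (if g.1 = α then -1 else 1 : ℚ))
        * (symTTab (ctr d L) L μ y (fref α f) (fref α f') (fref α g)
            - (if f = g ∧ f.1 = α then ((d ! : ℚ) ^ 2 * (L : ℚ) ^ d)⁻¹ * symHessCountAt (ctr d L) L μ y (fref α f) (fref α f') else 0)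
            + (if μ = α then ((d ! : ℚ) ^ 2 * (L : ℚ) ^ d)⁻¹ * ((d ! : ℚ) * (L : ℚ) ^ d)⁻¹
                * (symHessCountAt (ctr d L) L μ y (fref α f) (fref α f') * symLinCountAt (ctr d L) L μ y (fref α g)) else 0)) := by
  simp only [symTTab]
  rw [symATab_bref hL α μ f g f' y, symApTab_bref hL α μ f g f' y, symATab_bref hL α μ f' g f y,
    symHessCountAt_swap (ctr d L) L μ y (fref α f) (fref α f')]
  generalize (if f.1 = α then -1 else 1 : ℚ) = z₁
  generalize (if f'.1 = α then -1 else 1 : ℚ) = z₂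
  generalize (if g.1 = α then -1 else 1 : ℚ) = z₃
  have hd : (d ! : ℚ) ≠ 0 := Nat.cast_ne_zero.2 (Nat.factorial_ne_zero d)
  by_cases hff : f = f'
  · subst hff
    simp only [symHessCountAt_self, neg_zero, true_and, if_true]
    split_ifs <;> push_cast <;> (try field_simp) <;> ring
  · have hff' : ¬ f' = f := fun h => hff h.symm
    simp only [hff, hff', false_and, if_false]
    split_ifs <;> push_cast <;> ring

end Tables

/-! ## §3 The bond-level law of `symMixKerAt ρ_c`, MX4's matrix ⟺ bond equivalence for the sym tables, and the packed table-level law of `symMixFFAt ρ_c` -/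

section BondLaw

variable {Lc : ℕ}

open Classical in
/-- [folklore] **THE `(inl β, inl β′)` ENTRY OF THE RIGHT-HAND SIDE OF `symTableLaw`** in bond language (sym twin of MX4's `tableLaw_apply_inl_inl`,
root `ρ_c = ctr 4 Lc`). -/
theorem symTableLaw_apply_inl_inl (α κ : Fin 4) (u : Fin 4 → ℤ) (ρ' : Fin 4) (w : Fin 4 → ℤ) (β : Fin 4) (x : Fin 4 → ℤ)
    (β' : Fin 4) (z : Fin 4 → ℤ) :
    ((reflSign α κ * reflSign α ρ') • refK (Φ Lc α)
        (symMixFFAt (ctr 4 Lc) Lc κ u ρ' w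
          + (2 : ℝ) • comp (diagK (ctGen 3 α Lc κ u)) (symHessFFAt (ctr 4 Lc) Lc ρ' w)
          + (2 * (if ρ' = α then symLinKerAt (ctr 4 Lc) Lc ρ' w (κ, u) else 0)) • symHessFFAt (ctr 4 Lc) Lc ρ' w))
      x z (Sum.inl β) (Sum.inl β')
      = reflSign α κ * reflSign α ρ' * (reflSign α β * reflSign α β' *
          (symMixKerAt (ctr 4 Lc) Lc ρ' w (κ, u) (β, bref α β x) (β', bref α β' z)
            + 2 * (if bref α β x = u ∧ β = κ ∧ κ = α then -1 else 0)
                * symHessKerAt (ctr 4 Lc) Lc ρ' w (β, bref α β x) (β', bref α β' z)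
            + 2 * (if ρ' = α then symLinKerAt (ctr 4 Lc) Lc ρ' w (κ, u) else 0)
                * symHessKerAt (ctr 4 Lc) Lc ρ' w (β, bref α β x) (β', bref α β' z))) := by
  simp only [Pi.smul_apply, Pi.add_apply, smul_eq_mul, refK_apply, Φ_r_inl, Φ_s_inl, comp_diagK_left, ctGen_inl, symMixFFAt_inl_inl,
    symHessFFAt_inl_inl]
  ring

/-- [folklore] THE `ℚ`-TABLE READING: `symMixKerAt ρ L μ y g f f′ = (symTTab ρ L μ y f f′ g : ℝ)` (by `rfl`; sym twin of MX4's `mixKerAt_eq_tTab_cast`). -/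
theorem symMixKerAt_eq_symTTab_cast {d : ℕ} (ρ : Fin d → ℤ) (L : ℕ) (μ : Fin d) (y : Fin d → ℤ) (g f f' : Bond d) :
    symMixKerAt ρ L μ y g f f' = (symTTab ρ L μ y f f' g : ℝ) := rfl

open Classical in
/-- [folklore] **MATRIX LAW ⟺ BOND LAW** for the sym tables (sym twin of MX4's `tableLaw_iff_bondLaw`, root `ρ_c = ctr 4 Lc`): both `symMixFFAt` and
`symHessFFAt` are field–field supported, so the packed law is EQUIVALENT to the displayed scalar identity on the field–field entries. -/
theorem symTableLaw_iff_bondLaw :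
    (∀ (α κ : Fin 4) (u : Fin 4 → ℤ) (ρ' : Fin 4) (w : Fin 4 → ℤ),
      symMixFFAt (ctr 4 Lc) Lc κ (bref α κ u) ρ' (bref α ρ' w) =
        (reflSign α κ * reflSign α ρ') • refK (Φ Lc α)
          (symMixFFAt (ctr 4 Lc) Lc κ u ρ' w
            + (2 : ℝ) • comp (diagK (ctGen 3 α Lc κ u)) (symHessFFAt (ctr 4 Lc) Lc ρ' w)
            + (2 * (if ρ' = α then symLinKerAt (ctr 4 Lc) Lc ρ' w (κ, u) else 0)) • symHessFFAt (ctr 4 Lc) Lc ρ' w))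
    ↔ (∀ (α κ : Fin 4) (u : Fin 4 → ℤ) (ρ' : Fin 4) (w : Fin 4 → ℤ) (β : Fin 4) (x : Fin 4 → ℤ) (β' : Fin 4) (z : Fin 4 → ℤ),
      symMixKerAt (ctr 4 Lc) Lc ρ' (bref α ρ' w) (κ, bref α κ u) (β, x) (β', z)
        = reflSign α κ * reflSign α ρ' * (reflSign α β * reflSign α β' *
            (symMixKerAt (ctr 4 Lc) Lc ρ' w (κ, u) (β, bref α β x) (β', bref α β' z)
              + 2 * (if bref α β x = u ∧ β = κ ∧ κ = α then -1 else 0)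
                  * symHessKerAt (ctr 4 Lc) Lc ρ' w (β, bref α β x) (β', bref α β' z)
              + 2 * (if ρ' = α then symLinKerAt (ctr 4 Lc) Lc ρ' w (κ, u) else 0)
                  * symHessKerAt (ctr 4 Lc) Lc ρ' w (β, bref α β x) (β', bref α β' z)))) := by
  constructor
  · intro h α κ u ρ' w β x β' z
    have e := congrArg (fun K : MKer 4 (Fib 3) => K x z (Sum.inl β) (Sum.inl β')) (h α κ u ρ' w)
    simp only [symMixFFAt_inl_inl] at e
    rw [e]
    exact symTableLaw_apply_inl_inl α κ u ρ' w β x β' z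
  · intro h α κ u ρ' w
    funext x z a b
    rcases a with β | m
    · rcases b with β' | m'
      · rw [symMixFFAt_inl_inl, symTableLaw_apply_inl_inl, h]
      · -- (inl, inr): both sides vanish
        simp only [Pi.smul_apply, Pi.add_apply, smul_eq_mul, refK_apply, comp_diagK_left, symMixFFAt_inl_inr, symHessFFAt_inl_inr,
          mul_zero, add_zero]
    · -- (inr, ·): both sides vanish
      simp only [Pi.smul_apply, Pi.add_apply, smul_eq_mul, refK_apply, comp_diagK_left, symMixFFAt_inr, symHessFFAt_inr, mul_zero, add_zero]

open Classical in
/-- [folklore] **THE BOND-LEVEL MIXED REFLECTION LAW OF an1's SYM TABLE HOLDS** (`Lc` odd; sym twin of `RootedMixedTableLaw.bondLaw`, root `ρ_c = ctr 4 Lc`):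
§2's `symTTab_bref` at `d = 4` cast to `ℝ` by `symMixKerAt_eq_symTTab_cast`, in the LANDED real kernels `symHessKerAt = h_sym∕(2(d!)²L^d)`,
`symLinKerAt = q_sym∕(d!·L^d)` — the comb's outer shape UNCHANGED. -/
theorem symBondLaw (hLc : Odd Lc) :
    ∀ (α κ : Fin 4) (u : Fin 4 → ℤ) (ρ' : Fin 4) (w : Fin 4 → ℤ) (β : Fin 4) (x : Fin 4 → ℤ) (β' : Fin 4) (z : Fin 4 → ℤ),
      symMixKerAt (ctr 4 Lc) Lc ρ' (bref α ρ' w) (κ, bref α κ u) (β, x) (β', z)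
        = reflSign α κ * reflSign α ρ' * (reflSign α β * reflSign α β' *
            (symMixKerAt (ctr 4 Lc) Lc ρ' w (κ, u) (β, bref α β x) (β', bref α β' z)
              + 2 * (if bref α β x = u ∧ β = κ ∧ κ = α then -1 else 0)
                  * symHessKerAt (ctr 4 Lc) Lc ρ' w (β, bref α β x) (β', bref α β' z)
              + 2 * (if ρ' = α then symLinKerAt (ctr 4 Lc) Lc ρ' w (κ, u) else 0)
                  * symHessKerAt (ctr 4 Lc) Lc ρ' w (β, bref α β x) (β', bref α β' z))) := by
  intro α κ u ρ' w β x β' z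
  have hL0 : (Lc : ℝ) ≠ 0 := Nat.cast_ne_zero.2 hLc.pos.ne'
  have hd0 : ((4 ! : ℕ) : ℝ) ≠ 0 := Nat.cast_ne_zero.2 (Nat.factorial_ne_zero 4)
  have e := symTTab_bref (d := 4) hLc α ρ' (β, x) (β', z) (κ, bref α κ u) w
  simp only [fref_mk, bref_bref, contact_iff] at e
  rw [symMixKerAt_eq_symTTab_cast, symMixKerAt_eq_symTTab_cast, e]
  simp only [symHessKerAt, symLinKerAt, reflSign, div_eq_mul_inv, mul_inv]
  split_ifs <;> push_cast <;> ring

/-- [folklore] **THE PACKED TABLE-LEVEL MIXED REFLECTION LAW OF an1's SYM TABLE `symMixFFAt ρ_c Lc` HOLDS** (`Lc` odd; sym twin of `RootedMixedTableLaw.tableLaw`) —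
the second-order mixed REFLECTION letter of the sym root in MX2's packing, UNCONDITIONAL. -/
theorem symTableLaw (hLc : Odd Lc) :
    ∀ (α κ : Fin 4) (u : Fin 4 → ℤ) (ρ' : Fin 4) (w : Fin 4 → ℤ),
      symMixFFAt (ctr 4 Lc) Lc κ (bref α κ u) ρ' (bref α ρ' w) =
        (reflSign α κ * reflSign α ρ') • refK (Φ Lc α)
          (symMixFFAt (ctr 4 Lc) Lc κ u ρ' w
            + (2 : ℝ) • comp (diagK (ctGen 3 α Lc κ u)) (symHessFFAt (ctr 4 Lc) Lc ρ' w)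
            + (2 * (if ρ' = α then symLinKerAt (ctr 4 Lc) Lc ρ' w (κ, u) else 0)) • symHessFFAt (ctr 4 Lc) Lc ρ' w) :=
  symTableLaw_iff_bondLaw.2 (symBondLaw hLc)

end BondLaw

end Summit.QuantumFields.BalabanUV.Beta.SymRootedMixedTableLaw
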